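import Mathlib
import Summits.NavierStokesRegularity.NavierStokesRegularity.Theorems.EulerZoomLiouvillePowerGaugeEulerLiouvilleSelfSimilarVorticalEscape
import HarnessLib.Audit

/-!
# Rung C1 of the crux `EulerZoomLiouville.PowerGaugeEulerLiouville` (W3c portrait, sharpened): ALMOST EVERY VORTICAL PARTICLE OF A
# `C²` PROFILE PASSES THROUGH THE FAST-INFLOW SET `{⟪y, U y⟫ < −κ‖y‖²}` BEYOND EVERY RADIUS, for every `κ < γ`

Route №10 `EulerZoomLiouville` (NavierStokesRegularity), crux E = stmt-NavierStokesRegularity-19832, tenure rung C1,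
registered residue `stub_selfSimilarExtremalRest` (v21: `¬ IsTameC2Profile ρ V`), sub-stratum W3c.  Lineage ns-typeII-p1 (gen 8).
Sequel to `…SelfSimilarVorticalEscape` (a.e. vortical point has an UNBOUNDED backward similarity half-orbit) and
`…SelfSimilarRadialBarrierLoc` (no fast inflow near infinity ⇒ irrotational).

The barrier argument is PER ORBIT: along a single backward half-orbit `Y` (`Y' = −W(Y)` on `[0,∞)`, `W = γy + U`), if at
every time at which `‖Y t‖ ≥ R` the radial inequality `⟪Y t, U(Y t)⟫ ≥ −κ‖Y t‖²` (`κ < γ`) holds, then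
`t ↦ ‖Y t‖²` cannot cross the level `(max ‖Y 0‖ R)²` upwards (`norm_le_max_of_halfOrbit_of_inner`), so the orbit is bounded.
Combined with the portrait theorem: for every `κ < γ` and every `R`, **the set of vortical points admitting a backward
half-orbit that AVOIDS the fast-inflow set `{y : ⟪y, U y⟫ < −κ‖y‖²}` beyond radius `R` is Lebesgue-null**
(`volume_vortical_avoidingInflow_eq_zero`).  A.e. form: for a.e. `x` with `curl U x ≠ 0`, every backward half-orbit from `x`
visits the fast-inflow set at points of arbitrarily large norm (`ae_visits_inflow_of_curl_ne_zero`).  This is the kernel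
form of the census line «W3c = vorticity imported from infinity along fast-inflow channels»; no growth hypothesis at all.

WHAT THIS IS NOT: not NS, not E, not a closure of any stratum — a structural constraint on the OPEN `C²` residue.
[folklore; ConstantinIgnatovaVicol2026Putative §3.4–§3.5 (setting)]
-/

noncomputable section

-- flat `Theorems/<Route><Decl>…` files of one crux share the namespace of the crux (tree convention)
set_option linter.dupNamespace false

open MeasureTheory Set Filter Topology Metric Function InnerProductSpace
open scoped RealInnerProductSpace NNReal ENNReal ContDiff

namespace Summit.NavierStokesRegularity.NavierStokesRegularity.Theorems.PowerGaugeEulerLiouville.Loc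

open Literature.Analysis Literature.Analysis.FluidPDE
open Summit.NavierStokesRegularity.NavierStokesRegularity.Theorems.PowerGaugeEulerLiouville.Kelvin

variable {γ : ℝ} {U : EuclideanSpace ℝ (Fin 3) → EuclideanSpace ℝ (Fin 3)} {P : EuclideanSpace ℝ (Fin 3) → ℝ}

/-- **Per-orbit one-sided barrier**: let `Y` solve `Y' = −(γY + U(Y))` on `[0,∞)` (two-sided derivatives at `t ≥ 0`) and
suppose that at every time `t ≥ 0` with `‖Y t‖ ≥ R` one has `⟪Y t, U(Y t)⟫ ≥ −κ‖Y t‖²`, where `κ < γ` and `R > 0` (so `γ > κ`;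
no sign of `γ` is needed).  Then
`‖Y t‖ ≤ max ‖Y 0‖ R` for all `t ≥ 0` (fencing: `d/dt ‖Y‖² = −2γ‖Y‖² − 2⟪Y, U Y⟫ ≤ −2(γ−κ)‖Y‖² < 0` on the level). [folklore] -/
theorem norm_le_max_of_halfOrbit_of_inner {Y : ℝ → EuclideanSpace ℝ (Fin 3)}
    (hY : ∀ t, 0 ≤ t → HasDerivAt Y ((-1 : ℝ) • selfSimilarTransport γ 0 U (Y t)) t)
    {κ : ℝ} (hκ : κ < γ) {R : ℝ} (hR : 0 < R)
    (hfar : ∀ t, 0 ≤ t → R ≤ ‖Y t‖ → -(κ * ‖Y t‖ ^ 2) ≤ ⟪Y t, U (Y t)⟫) {t : ℝ} (ht : 0 ≤ t) :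
    ‖Y t‖ ≤ max ‖Y 0‖ R := by
  set m : ℝ := max ‖Y 0‖ R with hm
  have hm0 : 0 < m := lt_max_of_lt_right hR
  set g : ℝ → ℝ := fun s => ‖Y s‖ ^ 2 with hg
  set g' : ℝ → ℝ := fun s => 2 * ⟪Y s, (-1 : ℝ) • selfSimilarTransport γ 0 U (Y s)⟫ with hg'
  have hder : ∀ s, 0 ≤ s → HasDerivAt g (g' s) s := fun s hs => (hY s hs).norm_sq
  have key : ∀ ⦃s⦄, s ∈ Icc 0 t → g s ≤ m ^ 2 := by
    refine image_le_of_deriv_right_lt_deriv_boundary' (f := g) (f' := g') (a := 0) (b := t)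
      (fun s hs => (hder s hs.1).continuousAt.continuousWithinAt) (fun s hs => (hder s hs.1).hasDerivWithinAt)
      (B := fun _ => m ^ 2) (B' := fun _ => 0) ?_ continuousOn_const (fun s _ => (hasDerivAt_const s _).hasDerivWithinAt) ?_
    · exact pow_le_pow_left₀ (norm_nonneg _) (le_max_left _ _) 2
    · intro s hs hgs
      have hYn : ‖Y s‖ = m := (pow_left_inj₀ (norm_nonneg _) hm0.le two_ne_zero).1 hgs
      have hRY : R ≤ ‖Y s‖ := by rw [hYn]; exact le_max_right _ _
      have hinner := hfar s hs.1 hRY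
      have hcalc : g' s = -(2 * γ * ‖Y s‖ ^ 2) - 2 * ⟪Y s, U (Y s)⟫ := by
        simp only [hg', selfSimilarTransport_apply, sub_zero, inner_smul_right, inner_add_right,
          real_inner_self_eq_norm_sq]
        ring
      rw [hcalc]
      have hm2 : 0 < ‖Y s‖ ^ 2 := by rw [hYn]; positivity
      have hγκ : 0 < γ - κ := by linarith
      nlinarith [mul_pos hγκ hm2]
  have h := key ⟨ht, le_rfl⟩
  exact (pow_le_pow_iff_left₀ (norm_nonneg _) hm0.le two_ne_zero).1 h

/-- **VORTICAL POINTS WHOSE BACKWARD ORBIT AVOIDS THE FAST-INFLOW SET ARE NULL.**  `(U, P)` a `C²` self-similar Euler profile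
(CIV (3.3)), `0 < γ < ½`, `κ < γ`, any `R`: the set of `x` with `curl U x ≠ 0` admitting a backward half-orbit `Y` of
`W = γy + U` from `x` such that `⟪Y t, U(Y t)⟫ ≥ −κ‖Y t‖²` whenever `‖Y t‖ ≥ R` has Lebesgue measure zero (such an orbit is
bounded by the per-orbit barrier, and vortical points with a bounded backward orbit are null, `volume_vortical_confined_eq_zero`).
No growth hypothesis. [folklore] -/
theorem volume_vortical_avoidingInflow_eq_zero (hprof : IsSelfSimilarEulerProfile γ 0 U P)
    (hγ : 0 < γ) (hγ2 : γ < 1 / 2) {κ : ℝ} (hκ : κ < γ) (R : ℝ) :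
    volume {x : EuclideanSpace ℝ (Fin 3) | curl U x ≠ 0 ∧
      ∃ Y : ℝ → EuclideanSpace ℝ (Fin 3), Y 0 = x ∧
        (∀ t, 0 ≤ t → HasDerivAt Y ((-1 : ℝ) • selfSimilarTransport γ 0 U (Y t)) t) ∧
        ∀ t, 0 ≤ t → R ≤ ‖Y t‖ → -(κ * ‖Y t‖ ^ 2) ≤ ⟪Y t, U (Y t)⟫} = 0 := by
  set R' : ℝ := max R 1 with hR'
  have hR'0 : 0 < R' := lt_of_lt_of_le one_pos (le_max_right _ _)
  -- such points have backward orbits confined to `closedBall 0 n` for some `n`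
  have hsub : {x : EuclideanSpace ℝ (Fin 3) | curl U x ≠ 0 ∧
      ∃ Y : ℝ → EuclideanSpace ℝ (Fin 3), Y 0 = x ∧
        (∀ t, 0 ≤ t → HasDerivAt Y ((-1 : ℝ) • selfSimilarTransport γ 0 U (Y t)) t) ∧
        ∀ t, 0 ≤ t → R ≤ ‖Y t‖ → -(κ * ‖Y t‖ ^ 2) ≤ ⟪Y t, U (Y t)⟫} ⊆
      ⋃ n : ℕ, {x : EuclideanSpace ℝ (Fin 3) | curl U x ≠ 0 ∧
        ∃ Y : ℝ → EuclideanSpace ℝ (Fin 3), Y 0 = x ∧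
          (∀ t, 0 ≤ t → HasDerivAt Y ((-1 : ℝ) • selfSimilarTransport γ 0 U (Y t)) t) ∧
          ∀ t, 0 ≤ t → ‖Y t‖ ≤ (n : ℝ) + 1} := by
    rintro x ⟨hcx, Y, hY0, hYU, havoid⟩
    have hfar : ∀ t, 0 ≤ t → R' ≤ ‖Y t‖ → -(κ * ‖Y t‖ ^ 2) ≤ ⟪Y t, U (Y t)⟫ :=
      fun t ht hRt => havoid t ht ((le_max_left _ _).trans hRt)
    have hbd : ∀ t, 0 ≤ t → ‖Y t‖ ≤ max ‖Y 0‖ R' :=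
      fun t ht => norm_le_max_of_halfOrbit_of_inner hYU hκ hR'0 hfar ht
    obtain ⟨n, hn⟩ := exists_nat_ge (max ‖Y 0‖ R')
    exact mem_iUnion.2 ⟨n, hcx, Y, hY0, hYU, fun t ht => (hbd t ht).trans (hn.trans (by linarith))⟩
  refine measure_mono_null hsub (measure_iUnion_null fun n => ?_)
  exact volume_vortical_confined_eq_zero hprof hγ hγ2 (N := (n : ℝ) + 1) (by positivity)

/-- **A.e. vortical particle visits the fast-inflow set beyond every radius**: for every `κ < γ`, for almost every `x`, if
`curl U x ≠ 0` then every backward half-orbit `Y` of `W = γy + U` from `x` has, for every `R`, a time `t ≥ 0` with `‖Y t‖ ≥ R`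
and `⟪Y t, U (Y t)⟫ < −κ‖Y t‖²` (inward radial velocity faster than `κ‖y‖`). [folklore] -/
theorem ae_visits_inflow_of_curl_ne_zero (hprof : IsSelfSimilarEulerProfile γ 0 U P)
    (hγ : 0 < γ) (hγ2 : γ < 1 / 2) {κ : ℝ} (hκ : κ < γ) :
    ∀ᵐ x : EuclideanSpace ℝ (Fin 3) ∂volume, curl U x ≠ 0 →
      ∀ Y : ℝ → EuclideanSpace ℝ (Fin 3), Y 0 = x →
        (∀ t, 0 ≤ t → HasDerivAt Y ((-1 : ℝ) • selfSimilarTransport γ 0 U (Y t)) t) →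
        ∀ R : ℝ, ∃ t, 0 ≤ t ∧ R ≤ ‖Y t‖ ∧ ⟪Y t, U (Y t)⟫ < -(κ * ‖Y t‖ ^ 2) := by
  -- the union over natural radii of the avoiding sets is null
  have hnull : volume (⋃ n : ℕ, {x : EuclideanSpace ℝ (Fin 3) | curl U x ≠ 0 ∧
      ∃ Y : ℝ → EuclideanSpace ℝ (Fin 3), Y 0 = x ∧
        (∀ t, 0 ≤ t → HasDerivAt Y ((-1 : ℝ) • selfSimilarTransport γ 0 U (Y t)) t) ∧
        ∀ t, 0 ≤ t → (n : ℝ) ≤ ‖Y t‖ → -(κ * ‖Y t‖ ^ 2) ≤ ⟪Y t, U (Y t)⟫}) = 0 :=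
    measure_iUnion_null fun n => volume_vortical_avoidingInflow_eq_zero hprof hγ hγ2 hκ (n : ℝ)
  rw [← compl_mem_ae_iff] at hnull
  filter_upwards [hnull] with x hx
  intro hcx Y hY0 hYU R
  by_contra hcon
  push Not at hcon
  obtain ⟨n, hn⟩ := exists_nat_ge R
  apply hx
  refine mem_iUnion.2 ⟨n, hcx, Y, hY0, hYU, fun t ht hnt => hcon t ht (hn.trans hnt)⟩

end Summit.NavierStokesRegularity.NavierStokesRegularity.Theorems.PowerGaugeEulerLiouville.Loc

end
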